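import Summits.ValiantsHypothesis.ValiantsHypothesis.Theorems.BarrierLeverTransversalTwinFreeReduction

/-!
# Route BarrierLever — item `TransversalLiteralPairSplit` (R1, stmt-ValiantsHypothesis-19587),
# part 1/2: literal embeddings, the off-part, the ONE-ENTRY PERTURBATION formula, genericity

Helper file (`--supports stmt-ValiantsHypothesis-19587`; cell valiant-natproofs, rung V4, 𝒟-side;
prover seat val-np-p1; item typed by planner p1-g10). Part 2/2
(`BarrierLeverTransversalLiteralPairSplit.lean`) assembles the block argument and the item.
Conventions as in `…TransversalTwinFreeReduction.lean` (R2): `ρ_x = rowL x`, `κ_y = colL y`,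
`Θ_H[x, y] = det H[ρ_x, κ_y]`, projected points `x' = {b | a.succAbove b ∈ x}`.

**Contents.**
* `embRow a` / `embCol c`: the literal of coordinate `b : Fin h` with a given bit, read as a literal
  of coordinate `a.succAbove b` (resp. `c.succAbove b`) one dimension up; `offPart a c H` = the
  `(2h) × (2h)` matrix of `H` on the literals of coordinates `≠ a` (rows) / `≠ c` (columns);
  `offPart a c (lift a c H' Z) = H'` (`offPart_lift`).
* ONE-ENTRY PERTURBATION (`det_submatrix_add_single`): for the big literals `p₁ = (a, β)` (row) and
  `q₁ = (c, γ)` (column) and `E = single p₁ q₁`,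
  `Θ_{H + z•E}[x, y] = Θ_H[x, y] + z · (−1)^{a+c} · Θ_{offPart H}[x', y']` if `x_a = β` and
  `y_c = γ`, and `= Θ_H[x, y]` otherwise (`det_submatrix_add_single_of_ne`) — linearity of the
  determinant in the row of `a` and Laplace expansion.
* GENERICITY (`exists_common_witness`): if some big `H₁` makes a layout matrix of transversal
  minors nonsingular and some small `H'` makes a projected layout matrix nonsingular, ONE big `H`
  does both (with `offPart H` in the second) — the product of the two determinant polynomials in
  the entries of a generic matrix is nonzero (`MvPolynomial.funext` over the infinite field `ℂ`).

WHAT THIS IS NOT: no statement about the item yet (part 2); nothing on TT / TNS / item 19717 in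
general, on crux stmt-ValiantsHypothesis-14610, or on `VP` versus `VNP`.
-/

-- layout Summits/ValiantsHypothesis/ValiantsHypothesis forces the duplicated namespace component
set_option linter.dupNamespace false

namespace Summit.ValiantsHypothesis.ValiantsHypothesis.Theorems.BarrierLever.LiteralSplit

open Finset
open Summit.ValiantsHypothesis.ValiantsHypothesis.Theorems.BarrierLever.NearPrincipal
open Summit.ValiantsHypothesis.ValiantsHypothesis.Theorems.BarrierLever.Descent (rowL colL
  rowDec_rowL colDec_colL)
open Summit.ValiantsHypothesis.ValiantsHypothesis.Theorems.BarrierLever.LiteralLift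

variable {h : ℕ}

/-! ## 1. Literal embeddings and the off-part -/

/-- Embed a row literal of dimension `h` as a row literal of dimension `h+1` along `a.succAbove`
(same bit). -/
def embRow (a : Fin (h + 1)) (p : Fin (h + h)) : Fin ((h + 1) + (h + 1)) :=
  Fin.addCases (motive := fun _ => Fin ((h + 1) + (h + 1)))
    (fun b => Fin.castAdd (h + 1) (a.succAbove b)) (fun b => Fin.natAdd (h + 1) (a.succAbove b)) p

/-- Embed a column literal of dimension `h` as a column literal of dimension `h+1` along
`c.succAbove` (same bit). -/
def embCol (c : Fin (h + 1)) (q : Fin (h + h)) : Fin ((h + 1) + (h + 1)) :=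
  Fin.addCases (motive := fun _ => Fin ((h + 1) + (h + 1)))
    (fun d => Fin.castAdd (h + 1) (c.succAbove d)) (fun d => Fin.natAdd (h + 1) (c.succAbove d)) q

/-- `embRow` on a positive literal. -/
theorem embRow_castAdd (a : Fin (h + 1)) (b : Fin h) :
    embRow a (Fin.castAdd h b) = Fin.castAdd (h + 1) (a.succAbove b) := by
  unfold embRow; exact Fin.addCases_left _

/-- `embRow` on a negative literal. -/
theorem embRow_natAdd (a : Fin (h + 1)) (b : Fin h) :
    embRow a (Fin.natAdd h b) = Fin.natAdd (h + 1) (a.succAbove b) := by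
  unfold embRow; exact Fin.addCases_right _

/-- `embCol` on a `castAdd` literal. -/
theorem embCol_castAdd (c : Fin (h + 1)) (d : Fin h) :
    embCol c (Fin.castAdd h d) = Fin.castAdd (h + 1) (c.succAbove d) := by
  unfold embCol; exact Fin.addCases_left _

/-- `embCol` on a `natAdd` literal. -/
theorem embCol_natAdd (c : Fin (h + 1)) (d : Fin h) :
    embCol c (Fin.natAdd h d) = Fin.natAdd (h + 1) (c.succAbove d) := by
  unfold embCol; exact Fin.addCases_right _

/-- Row literals of the projected point embed to the row literals of the point. -/
theorem embRow_rowL (a : Fin (h + 1)) (x : Finset (Fin (h + 1))) (b : Fin h) :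
    embRow a (rowL (univ.filter (fun b : Fin h => a.succAbove b ∈ x)) b) =
      rowL x (a.succAbove b) := by
  rw [rowL_proj]
  unfold rowLit rowL
  by_cases hb : a.succAbove b ∈ x
  · rw [decide_eq_true hb, if_pos rfl, if_pos hb, embRow_castAdd]
  · rw [decide_eq_false hb, if_neg (by decide), if_neg hb, embRow_natAdd]

/-- Column literals of the projected point embed to the column literals of the point. -/
theorem embCol_colL (c : Fin (h + 1)) (y : Finset (Fin (h + 1))) (d : Fin h) :
    embCol c (colL (univ.filter (fun b : Fin h => c.succAbove b ∈ y)) d) =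
      colL y (c.succAbove d) := by
  rw [colL_proj]
  unfold colLit colL
  by_cases hd : c.succAbove d ∈ y
  · rw [decide_eq_true hd, if_pos rfl, if_pos hd, embCol_natAdd]
  · rw [decide_eq_false hd, if_neg (by decide), if_neg hd, embCol_castAdd]

/-- The OFF-PART of a big matrix: its entries on (literals of coordinates `≠ a`) × (literals of
coordinates `≠ c`), re-indexed one dimension down. -/
def offPart {R : Type*} (a c : Fin (h + 1))
    (H : Matrix (Fin ((h + 1) + (h + 1))) (Fin ((h + 1) + (h + 1))) R) :
    Matrix (Fin (h + h)) (Fin (h + h)) R :=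
  fun p q => H (embRow a p) (embCol c q)

/-- The off-part commutes with entrywise maps. -/
theorem offPart_map {R S : Type*} (a c : Fin (h + 1))
    (H : Matrix (Fin ((h + 1) + (h + 1))) (Fin ((h + 1) + (h + 1))) R) (f : R → S) :
    offPart a c (H.map f) = (offPart a c H).map f := rfl

/-- The off-part of the lift is the lifted matrix. -/
theorem offPart_lift (a c : Fin (h + 1)) (H' : Matrix (Fin (h + h)) (Fin (h + h)) ℂ)
    (Z : Bool → Bool → ℂ) : offPart a c (lift a c H' Z) = H' := by
  ext p q
  unfold offPart
  -- realise the literals `p`, `q` as literals of one-point / empty sets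
  have hp : ∀ p : Fin (h + h), ∃ (x : Finset (Fin (h + 1))) (b : Fin h),
      embRow a p = rowL x (a.succAbove b) ∧ p = rowLit b (decide (a.succAbove b ∈ x)) := by
    intro p
    refine Fin.addCases (fun b => ?_) (fun b => ?_) p
    · refine ⟨{a.succAbove b}, b, ?_, ?_⟩
      · unfold rowL; rw [if_pos (mem_singleton_self _), embRow_castAdd]
      · unfold rowLit; rw [decide_eq_true (mem_singleton_self _), if_pos rfl]
    · refine ⟨∅, b, ?_, ?_⟩
      · unfold rowL; rw [if_neg (Finset.notMem_empty _), embRow_natAdd]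
      · unfold rowLit; rw [decide_eq_false (Finset.notMem_empty _), if_neg (by decide)]
  have hq : ∀ q : Fin (h + h), ∃ (y : Finset (Fin (h + 1))) (d : Fin h),
      embCol c q = colL y (c.succAbove d) ∧ q = colLit d (decide (c.succAbove d ∈ y)) := by
    intro q
    refine Fin.addCases (fun d => ?_) (fun d => ?_) q
    · refine ⟨∅, d, ?_, ?_⟩
      · unfold colL; rw [if_neg (Finset.notMem_empty _), embCol_castAdd]
      · unfold colLit; rw [decide_eq_false (Finset.notMem_empty _), if_neg (by decide)]
    · refine ⟨{c.succAbove d}, d, ?_, ?_⟩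
      · unfold colL; rw [if_pos (mem_singleton_self _), embCol_natAdd]
      · unfold colLit; rw [decide_eq_true (mem_singleton_self _), if_pos rfl]
  obtain ⟨x, b, hxb, hpb⟩ := hp p
  obtain ⟨y, d, hyd, hqd⟩ := hq q
  rw [hxb, hyd, lift_succAbove, ← hpb, ← hqd]

/-! ## 2. The one-entry perturbation -/

/-- The single-entry matrix at (row literal `(a, β)`, column literal `(c, γ)`) of the big
dimension. -/
def single (a c : Fin (h + 1)) (β γ : Bool) :
    Matrix (Fin ((h + 1) + (h + 1))) (Fin ((h + 1) + (h + 1))) ℂ :=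
  fun p q => if p = rowLit a β ∧ q = colLit c γ then 1 else 0

/-- A row literal of the point `x` is the literal `(a, β)` iff it is the literal of `a` and
`x_a = β`. -/
theorem rowL_eq_rowLit_iff (x : Finset (Fin (h + 1))) (b a : Fin (h + 1)) (β : Bool) :
    rowL x b = rowLit a β ↔ b = a ∧ decide (a ∈ x) = β := by
  constructor
  · intro heq
    have h1 : rowDec (rowL x b) = rowDec (rowLit a β) := by rw [heq]
    rw [rowDec_rowL] at h1
    unfold rowLit at h1
    by_cases hβ : β = true
    · rw [if_pos hβ, rowDec_castAdd] at h1
      have h2 := (Prod.mk.inj h1)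
      refine ⟨h2.1, ?_⟩
      rw [← h2.1, h2.2, hβ]
    · rw [if_neg hβ, rowDec_natAdd] at h1
      have h2 := (Prod.mk.inj h1)
      refine ⟨h2.1, ?_⟩
      rw [← h2.1, h2.2]
      cases β
      · rfl
      · exact absurd rfl hβ
  · rintro ⟨rfl, hβ⟩
    rw [← hβ, rowLit_decide]

/-- A column literal of the point `y` is the literal `(c, γ)` iff it is the literal of `c` and
`y_c = γ`. -/
theorem colL_eq_colLit_iff (y : Finset (Fin (h + 1))) (d c : Fin (h + 1)) (γ : Bool) :
    colL y d = colLit c γ ↔ d = c ∧ decide (c ∈ y) = γ := by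
  constructor
  · intro heq
    have h1 : colDec (colL y d) = colDec (colLit c γ) := by rw [heq]
    rw [colDec_colL] at h1
    unfold colLit at h1
    by_cases hγ : γ = true
    · rw [if_pos hγ, colDec_natAdd] at h1
      have h2 := (Prod.mk.inj h1)
      refine ⟨h2.1, ?_⟩
      rw [← h2.1, h2.2, hγ]
    · rw [if_neg hγ, colDec_castAdd] at h1
      have h2 := (Prod.mk.inj h1)
      refine ⟨h2.1, ?_⟩
      rw [← h2.1, h2.2]
      cases γ
      · rfl
      · exact absurd rfl hγ
  · rintro ⟨rfl, hγ⟩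
    rw [← hγ, colLit_decide]

/-- The cofactor of the minor-entry `(a, c)`: the determinant of the matrix with the row of `a`
replaced by the unit vector at `c` is `(−1)^{a+c}` times the deleted minor. -/
theorem det_updateRow_single {n : ℕ} (A : Matrix (Fin (n + 1)) (Fin (n + 1)) ℂ)
    (a c : Fin (n + 1)) :
    (A.updateRow a (Pi.single c 1)).det =
      (-1) ^ ((a : ℕ) + (c : ℕ)) * (A.submatrix a.succAbove c.succAbove).det := by
  rw [Matrix.det_succ_row _ a, Finset.sum_eq_single c]
  · rw [Matrix.updateRow_self, Pi.single_eq_same, mul_one]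
    congr 1
    refine congr_arg _ ?_
    ext i j
    rw [Matrix.submatrix_apply, Matrix.submatrix_apply,
      Matrix.updateRow_ne (Fin.succAbove_ne a i)]
  · intro d _ hdc
    rw [Matrix.updateRow_self, Pi.single_eq_of_ne hdc, mul_zero, zero_mul]
  · intro hc; exact absurd (mem_univ c) hc

/-- ONE-ENTRY PERTURBATION, matching bits: if `x_a = β` and `y_c = γ` then
`Θ_{H + z•E}[x, y] = Θ_H[x, y] + z · (−1)^{a+c} · Θ_{offPart H}[x', y']`. -/
theorem det_submatrix_add_single (a c : Fin (h + 1)) (β γ : Bool)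
    (H : Matrix (Fin ((h + 1) + (h + 1))) (Fin ((h + 1) + (h + 1))) ℂ) (z : ℂ)
    (x y : Finset (Fin (h + 1))) (hx : decide (a ∈ x) = β) (hy : decide (c ∈ y) = γ) :
    ((H + z • single a c β γ).submatrix (rowL x) (colL y)).det =
      (H.submatrix (rowL x) (colL y)).det + z * ((-1) ^ ((a : ℕ) + (c : ℕ)) *
        ((offPart a c H).submatrix (rowL (univ.filter (fun b : Fin h => a.succAbove b ∈ x)))
          (colL (univ.filter (fun b : Fin h => c.succAbove b ∈ y)))).det) := by
  set A := H.submatrix (rowL x) (colL y) with hA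
  have hupd : (H + z • single a c β γ).submatrix (rowL x) (colL y) =
      A.updateRow a (A a + z • Pi.single c 1) := by
    ext b d
    rw [Matrix.submatrix_apply, Matrix.add_apply, Matrix.smul_apply, smul_eq_mul]
    by_cases hb : b = a
    · rw [hb, Matrix.updateRow_self, Pi.add_apply, Pi.smul_apply, smul_eq_mul, hA,
        Matrix.submatrix_apply]
      congr 1
      unfold single
      by_cases hd : d = c
      · rw [hd, Pi.single_eq_same, if_pos ⟨(rowL_eq_rowLit_iff x a a β).mpr ⟨rfl, hx⟩,
          (colL_eq_colLit_iff y c c γ).mpr ⟨rfl, hy⟩⟩]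
      · rw [Pi.single_eq_of_ne hd, if_neg (fun hh => hd ((colL_eq_colLit_iff y d c γ).mp hh.2).1)]
    · rw [Matrix.updateRow_ne hb, hA, Matrix.submatrix_apply]
      unfold single
      rw [if_neg (fun hh => hb ((rowL_eq_rowLit_iff x b a β).mp hh.1).1), mul_zero, add_zero]
  rw [hupd, Matrix.det_updateRow_add, Matrix.updateRow_eq_self, Matrix.det_updateRow_smul,
    det_updateRow_single]
  congr 2
  congr 2
  ext b d
  rw [Matrix.submatrix_apply, Matrix.submatrix_apply, hA, Matrix.submatrix_apply]
  unfold offPart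
  rw [embRow_rowL, embCol_colL]

/-- ONE-ENTRY PERTURBATION, non-matching bits: if `x_a ≠ β` or `y_c ≠ γ` the perturbed entry is
not in the minor and `Θ_{H + z•E}[x, y] = Θ_H[x, y]`. -/
theorem det_submatrix_add_single_of_ne (a c : Fin (h + 1)) (β γ : Bool)
    (H : Matrix (Fin ((h + 1) + (h + 1))) (Fin ((h + 1) + (h + 1))) ℂ) (z : ℂ)
    (x y : Finset (Fin (h + 1))) (hxy : decide (a ∈ x) ≠ β ∨ decide (c ∈ y) ≠ γ) :
    ((H + z • single a c β γ).submatrix (rowL x) (colL y)).det =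
      (H.submatrix (rowL x) (colL y)).det := by
  congr 1
  ext b d
  rw [Matrix.submatrix_apply, Matrix.add_apply, Matrix.smul_apply, smul_eq_mul,
    Matrix.submatrix_apply]
  unfold single
  rw [if_neg, mul_zero, add_zero]
  rintro ⟨h1, h2⟩
  rcases hxy with hx | hy
  · exact hx ((rowL_eq_rowLit_iff x b a β).mp h1).2
  · exact hy ((colL_eq_colLit_iff y d c γ).mp h2).2

/-! ## 3. Genericity: one matrix good for a layout and, through its off-part, for a projected one -/

/-- Layout determinants commute with ring homomorphisms applied entrywise. -/
theorem map_layoutDet {R S : Type*} [CommRing R] [CommRing S] (f : R →+* S) {r n N : ℕ}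
    (M : Matrix (Fin N) (Fin N) R) (ρ κ : Fin r → Fin n → Fin N) :
    f (Matrix.of fun i j : Fin r => (M.submatrix (ρ i) (κ j)).det).det =
      (Matrix.of fun i j : Fin r => ((M.map f).submatrix (ρ i) (κ j)).det).det := by
  rw [RingHom.map_det]
  congr 1
  ext i j
  rw [RingHom.mapMatrix_apply, Matrix.map_apply, Matrix.of_apply, Matrix.of_apply, RingHom.map_det,
    RingHom.mapMatrix_apply, Matrix.submatrix_map]

/-- GENERICITY. If some big matrix makes the layout matrix of `(u₂, w₂)` nonsingular and some small
matrix makes the layout matrix of the small layout `(u₁, w₁)` nonsingular, then ONE big matrix `H`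
makes both nonsingular, the second through `offPart a c H`. -/
theorem exists_common_witness (a c : Fin (h + 1)) {k m : ℕ}
    (u₁ w₁ : Fin k → Finset (Fin h)) (u₂ w₂ : Fin m → Finset (Fin (h + 1)))
    (h₁ : ∃ H' : Matrix (Fin (h + h)) (Fin (h + h)) ℂ,
      (Matrix.of fun i j : Fin k => (H'.submatrix (rowL (u₁ i)) (colL (w₁ j))).det).det ≠ 0)
    (h₂ : ∃ H : Matrix (Fin ((h + 1) + (h + 1))) (Fin ((h + 1) + (h + 1))) ℂ,
      (Matrix.of fun i j : Fin m => (H.submatrix (rowL (u₂ i)) (colL (w₂ j))).det).det ≠ 0) :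
    ∃ H : Matrix (Fin ((h + 1) + (h + 1))) (Fin ((h + 1) + (h + 1))) ℂ,
      (Matrix.of fun i j : Fin k =>
          ((offPart a c H).submatrix (rowL (u₁ i)) (colL (w₁ j))).det).det ≠ 0 ∧
      (Matrix.of fun i j : Fin m => (H.submatrix (rowL (u₂ i)) (colL (w₂ j))).det).det ≠ 0 := by
  classical
  obtain ⟨H', hH'⟩ := h₁
  obtain ⟨H₁, hH₁⟩ := h₂
  -- the generic big matrix
  set Xs : Matrix (Fin ((h + 1) + (h + 1))) (Fin ((h + 1) + (h + 1)))
      (MvPolynomial (Fin ((h + 1) + (h + 1)) × Fin ((h + 1) + (h + 1))) ℂ) :=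
    fun p q => MvPolynomial.X (p, q) with hXs
  have hev : ∀ H : Matrix (Fin ((h + 1) + (h + 1))) (Fin ((h + 1) + (h + 1))) ℂ,
      Xs.map (MvPolynomial.eval
        (fun s : Fin ((h + 1) + (h + 1)) × Fin ((h + 1) + (h + 1)) => H s.1 s.2)) = H := by
    intro H
    ext p q
    rw [Matrix.map_apply, hXs]
    exact MvPolynomial.eval_X _
  set P : MvPolynomial (Fin ((h + 1) + (h + 1)) × Fin ((h + 1) + (h + 1))) ℂ :=
    (Matrix.of fun i j : Fin m => (Xs.submatrix (rowL (u₂ i)) (colL (w₂ j))).det).det with hP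
  set Q : MvPolynomial (Fin ((h + 1) + (h + 1)) × Fin ((h + 1) + (h + 1))) ℂ :=
    (Matrix.of fun i j : Fin k =>
      ((offPart a c Xs).submatrix (rowL (u₁ i)) (colL (w₁ j))).det).det with hQ
  have hPev : ∀ H : Matrix (Fin ((h + 1) + (h + 1))) (Fin ((h + 1) + (h + 1))) ℂ,
      MvPolynomial.eval (fun s : Fin ((h + 1) + (h + 1)) × Fin ((h + 1) + (h + 1)) => H s.1 s.2) P =
        (Matrix.of fun i j : Fin m => (H.submatrix (rowL (u₂ i)) (colL (w₂ j))).det).det := by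
    intro H
    rw [hP, map_layoutDet, hev]
  have hQev : ∀ H : Matrix (Fin ((h + 1) + (h + 1))) (Fin ((h + 1) + (h + 1))) ℂ,
      MvPolynomial.eval (fun s : Fin ((h + 1) + (h + 1)) × Fin ((h + 1) + (h + 1)) => H s.1 s.2) Q =
        (Matrix.of fun i j : Fin k =>
          ((offPart a c H).submatrix (rowL (u₁ i)) (colL (w₁ j))).det).det := by
    intro H
    rw [hQ, map_layoutDet, ← offPart_map, hev]
  have hP0 : P ≠ 0 := fun h0 => hH₁ (by rw [← hPev H₁, h0, map_zero])
  have hQ0 : Q ≠ 0 := fun h0 => by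
    apply hH'
    rw [← offPart_lift a c H' (fun _ _ => 1), ← hQev, h0, map_zero]
  have hPQ : P * Q ≠ 0 := mul_ne_zero hP0 hQ0
  -- a common non-root
  obtain ⟨g, hg⟩ : ∃ g : Fin ((h + 1) + (h + 1)) × Fin ((h + 1) + (h + 1)) → ℂ,
      MvPolynomial.eval g (P * Q) ≠ 0 := by
    by_contra hcon
    refine hPQ (MvPolynomial.funext (fun g => ?_))
    rw [map_zero]
    by_contra hg
    exact hcon ⟨g, hg⟩
  refine ⟨fun p q => g (p, q), ?_, ?_⟩
  · rw [← hQev]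
    exact fun h0 => hg (by rw [map_mul, h0, mul_zero])
  · rw [← hPev]
    exact fun h0 => hg (by rw [map_mul, h0, zero_mul])

end Summit.ValiantsHypothesis.ValiantsHypothesis.Theorems.BarrierLever.LiteralSplit
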